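import Mathlib
import Summits.Ventures.PercRepro2.Harris
import Summits.Ventures.PercRepro2.BasePrime
import Summits.Ventures.PercRepro2.LocRows
import Summits.Ventures.PercRepro2.SwRow
import Summits.Ventures.PercRepro2.SwOutCube
import Summits.Ventures.PercRepro2.SwOutMixedCubeFarDefs
import Summits.Ventures.PercRepro2.SwOutBigBlockDefs
import Summits.Ventures.PercRepro2.SwOutMixedCore
import Summits.Ventures.PercRepro2.SwOutMixedCorePieces

/-!
# The three pieces are lower sets of their cubes (blind cell PercRepro2, night-4 g18, 2026-08-27;
proofs/NIGHT4-G18.md §2)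

Vocabulary in `SwOutMixedCore` (the corrected leak set `Leak'`, `Core`, `Pair`, `G5`, the cubes
`core` / `esc` / `pair`, the projections `projA` / `projB` / `projC`) and `SwOutMixedCorePieces`
(the special points `Fpt`, `D01`, `D00`, `xpt`, `xbar` and the pieces `inA Q` / `inB Q` / `inC`).

This file: the pieces as finite sets `SA Q` / `SB Q` / `SC Q`, the image of each piece in its cube
(`mem_image_projA`: the core points of `Q` and `(⊥, 1, f)` when `D01 f ∈ Q`; `mem_image_projB`:
`(1, a, f)` when `D(1, a, f) ∈ Q`, `(0, 1, f)` when `F(⊥, 1, f) ∈ Q`, `(0, 0, f)` when `x̄(f) ∈ Q`;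
`mem_image_projC`: `(1, f)` when `x(f) ∈ Q`, `(0, f)` when `D00 f ∈ Q`), and the theorem that each
image is a LOWER set of its cube when `Q` is lower and satisfies `G5` (`isLowerSet_image_projA` /
`_projB` / `_projC`): the order of the raw cube, and `G5` three times — `D(1, 1, f) ⇒ F(⊥, 1, f)`,
`D(1, 0, f) ⇒ x̄(f)`, `x(f) ⇒ D01 f`.  The counting is in `SwOutMixedCoreThm`.
-/

namespace Summit.Ventures.PercRepro2

namespace BigBlock

open scoped Classical

variable {ι κ : Type*} [Fintype ι] [DecidableEq ι] [Fintype κ] [DecidableEq κ]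

section PieceA

variable (Q : Set (Pt ι κ))

/-- The points of piece A in `Q`. -/
noncomputable def SA : Finset (Pt ι κ) := Finset.univ.filter fun p => p ∈ Q ∧ inA Q p

/-- The points of piece B in `Q`. -/
noncomputable def SB : Finset (Pt ι κ) := Finset.univ.filter fun p => p ∈ Q ∧ inB Q p

/-- The points of piece C in `Q`. -/
noncomputable def SC : Finset (Pt ι κ) := Finset.univ.filter fun p => p ∈ Q ∧ inC p

variable {Q}

/-- Membership in piece A. -/
lemma mem_SA {p : Pt ι κ} : p ∈ SA Q ↔ p ∈ Q ∧ inA Q p := by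
  simp only [SA, Finset.mem_filter, Finset.mem_univ, true_and]

/-- Membership in piece B. -/
lemma mem_SB {p : Pt ι κ} : p ∈ SB Q ↔ p ∈ Q ∧ inB Q p := by
  simp only [SB, Finset.mem_filter, Finset.mem_univ, true_and]

/-- Membership in piece C. -/
lemma mem_SC {p : Pt ι κ} : p ∈ SC Q ↔ p ∈ Q ∧ inC p := by
  simp only [SC, Finset.mem_filter, Finset.mem_univ, true_and]

/-- The image of piece A in the core cube: the core points of `Q`, and `(⊥, 1, f)` when `D01 f ∈ Q`. -/
lemma mem_image_projA (x : Config (ι ⊕ (Unit ⊕ κ))) :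
    x ∈ projA '' (SA Q : Set (Pt ι κ)) ↔
      core x ∈ Q ∨ ((fun j => x (Sum.inl j)) = (fun _ => false) ∧ x (Sum.inr (Sum.inl ())) = true ∧
        D01 (fun k => x (Sum.inr (Sum.inr k))) ∈ Q) := by
  constructor
  · rintro ⟨p, hp, rfl⟩
    simp only [SA, Finset.coe_filter, Finset.mem_univ, true_and, Set.mem_setOf_eq] at hp
    rcases hp.2 with hC | ⟨hD, he, ha, _⟩
    · left
      rw [← eq_core_projA_of_Core hC]
      exact hp.1
    · right
      refine ⟨?_, ha, ?_⟩
      · funext j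
        show p.1 j = false
        rw [hD.1]
        exact he
      · show D01 p.2.2.2.2 ∈ Q
        rw [← eq_D01_of_D hD he ha]
        exact hp.1
  · intro hx
    by_cases hc : core x ∈ Q
    · refine ⟨core x, ?_, projA_core x⟩
      simp only [SA, Finset.coe_filter, Finset.mem_univ, true_and, Set.mem_setOf_eq]
      exact ⟨hc, Or.inl ⟨rfl, rfl⟩⟩
    · rcases hx with hx | ⟨hs, hc', hD⟩
      · exact absurd hx hc
      · refine ⟨D01 (fun k => x (Sum.inr (Sum.inr k))), ?_, ?_⟩
        · simp only [SA, Finset.coe_filter, Finset.mem_univ, true_and, Set.mem_setOf_eq]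
          refine ⟨hD, Or.inr ⟨D_D01 _, rfl, rfl, ?_⟩⟩
          have : core (projA (D01 (fun k => x (Sum.inr (Sum.inr k))) : Pt ι κ)) = core x :=
            Prod.ext hs.symm (Prod.ext hc'.symm (Prod.ext hc'.symm (Prod.ext hc'.symm rfl)))
          rw [this]
          exact hc
        · funext z
          rcases z with j | (⟨⟩ | k)
          · exact (congrFun hs j).symm
          · exact hc'.symm
          · rfl

/-- **Piece A is a lower set of the core cube** (`Q` lower). -/
lemma isLowerSet_image_projA (hQ : IsLowerSet Q) :
    IsLowerSet (projA '' (SA Q : Set (Pt ι κ))) := by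
  intro x y hle hx
  rw [mem_image_projA] at hx ⊢
  rcases hx with hx | ⟨hs, hc, hD⟩
  · exact Or.inl (hQ (core_mono hle) hx)
  · have hs' : (fun j => y (Sum.inl j)) = fun _ => false := by
      funext j
      exact false_of_le_false ((congrFun hs j) ▸ hle (Sum.inl j))
    have hf' : (fun k => y (Sum.inr (Sum.inr k))) ≤ fun k => x (Sum.inr (Sum.inr k)) :=
      fun k => hle _
    cases hc' : y (Sum.inr (Sum.inl ()))
    · left
      apply hQ _ hD
      refine ⟨fun j => ?_, ?_, ?_, ?_, hf'⟩
      · show y (Sum.inl j) ≤ false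
        rw [congrFun hs' j]
      · show y (Sum.inr (Sum.inl ())) ≤ true
        exact Bool.le_true _
      · show y (Sum.inr (Sum.inl ())) ≤ true
        exact Bool.le_true _
      · show y (Sum.inr (Sum.inl ())) ≤ false
        rw [hc']
    · exact Or.inr ⟨hs', rfl, hQ (D01_mono hf') hD⟩

end PieceA

section PieceB

variable {Q : Set (Pt ι κ)}

/-- The image of piece B in the escaping cube: `(1, a, f)` when `D(1, a, f) ∈ Q`, `(0, 1, f)` when
`F(⊥, 1, f) ∈ Q`, and `(0, 0, f)` when `x̄(f) ∈ Q` (`Q` lower). -/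
lemma mem_image_projB (hQ : IsLowerSet Q) (y : Config (Fin 2 ⊕ κ)) :
    y ∈ projB '' (SB Q : Set (Pt ι κ)) ↔
      (y (Sum.inl 0) = true ∧ esc y ∈ Q) ∨
        (y (Sum.inl 0) = false ∧ y (Sum.inl 1) = true ∧
          Fpt (fun _ => false) true (fun k => y (Sum.inr k)) ∈ Q) ∨
        (y (Sum.inl 0) = false ∧ y (Sum.inl 1) = false ∧ xbar (fun k => y (Sum.inr k)) ∈ Q) := by
  constructor
  · rintro ⟨p, hp, rfl⟩
    simp only [SB, Finset.coe_filter, Finset.mem_univ, true_and, Set.mem_setOf_eq] at hp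
    rcases hp.2 with ⟨hD, h00, h01⟩ | ⟨hP, he⟩
    · have hpe := eq_esc_projB_of_D hD
      have ht : projB p (Sum.inl 0) = !p.2.2.1 := rfl
      have hu : p.2.2.1 = !p.2.2.2.1 := hD.2
      cases he : p.2.2.2.1
      · -- `e = false`: `a = true`, and `F(⊥, 1, f) ∈ Q`
        have ha : p.2.1 = true := by
          cases ha : p.2.1
          · exact absurd ⟨he, ha⟩ h00
          · rfl
        have hF : core (projA p) ∈ Q := by
          by_contra hn
          exact h01 ⟨he, ha, hn⟩
        right; left
        refine ⟨?_, ha, ?_⟩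
        · rw [ht, hu, he]
          rfl
        · have : core (projA p) = Fpt (fun _ => false) true (fun k => projB p (Sum.inr k)) := by
            rw [core_projA]
            refine Prod.ext ?_ (Prod.ext ha (Prod.ext ha (Prod.ext ha rfl)))
            show p.1 = fun _ => false
            rw [hD.1, he]
          rw [← this]
          exact hF
      · -- `e = true`: the point is `esc` of its projection
        left
        refine ⟨?_, ?_⟩
        · rw [ht, hu, he]
          rfl
        · rw [← hpe]
          exact hp.1
    · right; right
      have hx := eq_xbar_of_Pair hP he
      refine ⟨?_, ?_, ?_⟩
      · show (!p.2.2.1) = false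
        rw [hP.2.2, he]
        rfl
      · show p.2.1 = false
        rw [hP.2.1, he]
        rfl
      · show xbar p.2.2.2.2 ∈ Q
        rw [← hx]
        exact hp.1
  · rintro (⟨ht, hy⟩ | ⟨ht, ha, hF⟩ | ⟨ht, ha, hx⟩)
    · refine ⟨esc y, ?_, projB_esc y⟩
      simp only [SB, Finset.coe_filter, Finset.mem_univ, true_and, Set.mem_setOf_eq]
      refine ⟨hy, Or.inl ⟨(esc_range _).2 ⟨y, rfl⟩, ?_, ?_⟩⟩
      · rintro ⟨h, _⟩
        change y (Sum.inl 0) = false at h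
        rw [ht] at h
        exact absurd h (by decide)
      · rintro ⟨h, _⟩
        change y (Sum.inl 0) = false at h
        rw [ht] at h
        exact absurd h (by decide)
    · refine ⟨D01 (fun k => y (Sum.inr k)), ?_, ?_⟩
      · simp only [SB, Finset.coe_filter, Finset.mem_univ, true_and, Set.mem_setOf_eq]
        refine ⟨hQ (D01_le_Fpt _) hF, Or.inl ⟨D_D01 _, ?_, ?_⟩⟩
        · rintro ⟨_, h⟩
          exact absurd h (by simp [D01])
        · rintro ⟨_, _, h⟩
          exact h hF
      · funext z
        rcases z with i | k
        · fin_cases i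
          · exact ht.symm
          · exact ha.symm
        · rfl
    · refine ⟨xbar (fun k => y (Sum.inr k)), ?_, ?_⟩
      · simp only [SB, Finset.coe_filter, Finset.mem_univ, true_and, Set.mem_setOf_eq]
        exact ⟨hx, Or.inr ⟨Pair_xbar _, rfl⟩⟩
      · funext z
        rcases z with i | k
        · fin_cases i
          · exact ht.symm
          · exact ha.symm
        · rfl

/-- **Piece B is a lower set of the escaping cube** (`Q` lower with `G5`). -/
lemma isLowerSet_image_projB (hQ : IsLowerSet Q) (hG : G5 Q) :
    IsLowerSet (projB '' (SB Q : Set (Pt ι κ))) := by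
  intro y y' hle hy
  rw [mem_image_projB hQ] at hy ⊢
  have hf' : (fun k => y' (Sum.inr k)) ≤ fun k => y (Sum.inr k) := fun k => hle _
  rcases hy with ⟨ht, hy⟩ | ⟨ht, ha, hF⟩ | ⟨ht, ha, hx⟩
  · cases ht' : y' (Sum.inl 0)
    · cases ha' : y' (Sum.inl 1)
      · -- `(0, 0, f')`: `x̄(f') ∈ Q` through `D(1, 0, f) ∈ Q` and `G5`
        right; right
        refine ⟨rfl, rfl, ?_⟩
        have h10 : ((fun _ => true), false, false, true, fun k => y (Sum.inr k)) ∈ Q := by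
          apply hQ _ hy
          refine ⟨fun _ => le_of_eq ht.symm, Bool.false_le _, ?_, ?_, fun _ => le_rfl⟩
          · show false ≤ !(y (Sum.inl 0))
            exact Bool.false_le _
          · exact le_of_eq ht.symm
        exact hQ (xbar_mono hf') (hG false true _ h10)
      · -- `(0, 1, f')`: `F(⊥, 1, f') ∈ Q` through `D(1, 1, f) ∈ Q` and `G5`
        right; left
        refine ⟨rfl, rfl, ?_⟩
        have ha : y (Sum.inl 1) = true := true_le_imp (hle (Sum.inl 1)) ha'
        have h11 : ((fun _ => true), true, false, true, fun k => y (Sum.inr k)) ∈ Q := by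
          have : esc y = (((fun _ => true) : Config ι), true, false, true, fun k => y (Sum.inr k)) := by
            simp only [esc, ht, ha]
            rfl
          rw [← this]
          exact hy
        exact hQ (Fpt_bot_true_mono hf') (hG true true _ h11)
    · -- `(1, a', f')`: below `(1, a, f)` in the escaping cube
      left
      exact ⟨rfl, hQ (esc_le_esc_of_eq hle (by rw [ht', ht])) hy⟩
  · have ht' : y' (Sum.inl 0) = false := false_of_le_false (ht ▸ hle (Sum.inl 0))
    cases ha' : y' (Sum.inl 1)
    · right; right
      exact ⟨ht', rfl, hQ (le_trans (xbar_mono hf') (xbar_le_Fpt _)) hF⟩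
    · right; left
      exact ⟨ht', rfl, hQ (Fpt_bot_true_mono hf') hF⟩
  · have ht' : y' (Sum.inl 0) = false := false_of_le_false (ht ▸ hle (Sum.inl 0))
    have ha' : y' (Sum.inl 1) = false := false_of_le_false (ha ▸ hle (Sum.inl 1))
    right; right
    exact ⟨ht', ha', hQ (xbar_mono hf') hx⟩

end PieceB

section PieceC

variable {Q : Set (Pt ι κ)}

/-- The image of piece C in the pair cube: `(1, f)` when `x(f) ∈ Q` and `(0, f)` when `D00(f) ∈ Q`. -/
lemma mem_image_projC (z : Config (Unit ⊕ κ)) :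
    z ∈ projC '' (SC Q : Set (Pt ι κ)) ↔
      (z (Sum.inl ()) = true ∧ xpt (fun k => z (Sum.inr k)) ∈ Q) ∨
        (z (Sum.inl ()) = false ∧ D00 (fun k => z (Sum.inr k)) ∈ Q) := by
  constructor
  · rintro ⟨p, hp, rfl⟩
    simp only [SC, Finset.coe_filter, Finset.mem_univ, true_and, Set.mem_setOf_eq] at hp
    rcases hp.2 with ⟨hP, he⟩ | ⟨hD, he, ha⟩
    · left
      refine ⟨?_, ?_⟩
      · show p.2.1 = true
        rw [hP.2.1, he]
        rfl
      · show xpt p.2.2.2.2 ∈ Q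
        rw [← eq_xpt_of_Pair hP he]
        exact hp.1
    · right
      refine ⟨ha, ?_⟩
      show D00 p.2.2.2.2 ∈ Q
      rw [← eq_D00_of_D hD he ha]
      exact hp.1
  · rintro (⟨ht, hx⟩ | ⟨ht, hD⟩)
    · refine ⟨xpt (fun k => z (Sum.inr k)), ?_, ?_⟩
      · simp only [SC, Finset.coe_filter, Finset.mem_univ, true_and, Set.mem_setOf_eq]
        exact ⟨hx, Or.inl ⟨Pair_xpt _, rfl⟩⟩
      · funext w
        rcases w with ⟨⟩ | k
        · exact ht.symm
        · rfl
    · refine ⟨D00 (fun k => z (Sum.inr k)), ?_, ?_⟩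
      · simp only [SC, Finset.coe_filter, Finset.mem_univ, true_and, Set.mem_setOf_eq]
        exact ⟨hD, Or.inr ⟨D_D00 _, rfl, rfl⟩⟩
      · funext w
        rcases w with ⟨⟩ | k
        · exact ht.symm
        · rfl

/-- **Piece C is a lower set of the pair cube** (`Q` lower with `G5`). -/
lemma isLowerSet_image_projC (hQ : IsLowerSet Q) (hG : G5 Q) :
    IsLowerSet (projC '' (SC Q : Set (Pt ι κ))) := by
  intro z z' hle hz
  rw [mem_image_projC] at hz ⊢
  have hf' : (fun k => z' (Sum.inr k)) ≤ fun k => z (Sum.inr k) := fun k => hle _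
  rcases hz with ⟨ht, hx⟩ | ⟨ht, hD⟩
  · cases ht' : z' (Sum.inl ())
    · -- `(0, f')`: `D00(f') ∈ Q` through `x(f) ∈ Q` and `G5`
      right
      refine ⟨rfl, ?_⟩
      have h01 : ((fun _ => false), true, true, false, fun k => z (Sum.inr k)) ∈ Q :=
        hG true false _ hx
      exact hQ (le_trans (D00_mono hf') (D00_le_D01 _)) h01
    · left
      exact ⟨rfl, hQ (xpt_mono hf') hx⟩
  · have ht' : z' (Sum.inl ()) = false := false_of_le_false (ht ▸ hle (Sum.inl ()))
    right
    exact ⟨ht', hQ (D00_mono hf') hD⟩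

end PieceC
end BigBlock

end Summit.Ventures.PercRepro2
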